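import Summits.QuantumFields.BalabanUV.Beta.D1BFx.ModelTablesRealised
import Summits.QuantumFields.BalabanUV.Beta.D1BFx.GhostStencilRooted

/-!
# `BalabanUV.Beta.D1BFx.GhostCurrentRealised` — road «BF-x» for binder row D1, slot (SPLIT) ∕ leaf A1.ii, part 5a: THE ROAD'S GHOST KINETIC CURRENT
# `GhostStencil.ghCur κ u` IS THE KERNEL REALISATION OF an3's COLOURLESS GHOST LIST `VecTableZ4.ghostStn κ 1`; hence the ghost stencil of record
# splits `SghAt ρ n cK cQ κ u = cK • realK u u (ghostStn κ 1) + cQ • qAntiAt ρ n κ u` (KIN + averaging-jet block) and the KIN × KIN bubble over a frozen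
# even leg is an3's ghost table `2·cellForm g`

HONEST DEPENDENCY (page 1, mandatory): continuum YM on T⁴ ⇐ BetaPertH ∧ nine spine estimates (0/9 proved); BetaPertH ⇐ (D1) ∧ (D4) ∧
CAP+tail; G-an2-4 gates asym, D1 and NE2/3/4.  HONEST FRAMING (cell contract, verbatim): «discharging `BetaPertH` makes Bałaban's UV
stability UNCONDITIONAL — a real constructive-QFT result; it is NOT the continuum limit and NOT the Clay problem.»  THIS MODULE DISCHARGES
NOTHING of the wall: [folklore] unfolding BY NAME of the typer's `GhostStencil.ghCur` (T6), leaf-01's `GhostStencilRooted.SghAt` (T6-ρ, the ghost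
first-order stencil of record per OWNER-RULINGS-1 R-4), an3's `VecTableZ4.ghostStn` and this unit's `StencilRealisation.realK` ∕ `ModelTablesRealised`.
No `def`, no `Prop` minted, nothing printed asserted, 0 sorry.  0 wall binders; NOT D1, NOT `BetaPertH`, NOT continuum, NOT Clay.

ABSOLUTE RULE (cell charter, verbatim): «No internally-minted statement may enter as a cited fact. Every hypothesis is either kernel-proved in
this package or a verbatim quotation of a PUBLISHED theorem with page reference. The manuscript(s) under audit are NOT citable for their own
disputed steps — they are the thing under adjudication; programme-internal (2001/route/tribunal) claims are never citable.»

WHY (skeleton v1.6 slot (SPLIT) = A0 ∘ A1.ii; parts 4a `ModelTablesRealised`, 4b `ColourlessAntisymmetry`).  The MAIN term's ghost sector is the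
kinetic current against itself over the frozen leg; part 4a evaluated an3's `ghostStn` table in the road's currency; THIS FILE identifies the
road's own ghost current with that list (§1) and records the ghost line of node A0's term list (§2: KIN + the block-structured averaging jet
`cQ • qAntiAt`, a REST object of A3.a class), so that `bubble_ghCur_ghCur_frozen` (§3) is the ghost MAIN table `2·cellForm g u_μ u_ν v`.
* §1 `unitVec_affine_eq` (the two `unitVec`s agree on `ℤ⁴`), **`ghCur_eq_realK`**: `ghCur κ u = realK u u (ghostStn κ 1)`.
* §2 **`SghAt_split`**: `SghAt ρ n cK cQ κ u = cK • realK u u (ghostStn κ 1) + cQ • qAntiAt ρ n κ u`.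
* §3 **`bubble_ghCur_ghCur_frozen`**: `g` even, frozen leg `B x y a b = δ_{ab}·g (y − x)` on the ghost fibre `Unit`:
  `bubble B (ghCur μ u) (ghCur ν (u + (v + u_μ))) = 2·cellForm g u_μ u_ν v`.
Unit `b2b-balaban-beta-d1-p2` (road owner, gen 2); `LEAVES-BFx.md` row A1.ii (part 5a) ∕ A0 (ghost line).
-/

open Finset
open scoped BigOperators
open Literature.MathematicalPhysics.QuantumFieldTheory.Balaban1983to89
open Literature.MathematicalPhysics.QuantumFieldTheory.Balaban1983to89.Beta
open ExpKernelCalculus (Site MKer bubble)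
open DyadicShell (Pt)
open BubbleTransfer (unitVec)
open GradedBubbles (LP Stn smulS rowSh colSh rowDiff colDiff)
open GhostTable (cellForm)
open Summit.QuantumFields.BalabanUV.Beta.VecTableZ4 (ghostStn)
open Summit.QuantumFields.BalabanUV.Beta.WilsonStencilZ4 (pt)
open Summit.QuantumFields.BalabanUV.Beta.D1BFx.FiniteStencilCalculus (elemK elemK_apply)
open Summit.QuantumFields.BalabanUV.Beta.D1BFx.StencilRealisation (realK realK_nil realK_cons)
open Summit.QuantumFields.BalabanUV.Beta.D1BFx.ModelTablesRealised (bubble_ghostStn_frozen)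
open Summit.QuantumFields.BalabanUV.Beta.D1BFx.GhostStencil (ghCur ghCur_apply)
open Summit.QuantumFields.BalabanUV.Beta.D1BFx.GhostStencilRooted (SghAt qAntiAt)

namespace Summit.QuantumFields.BalabanUV.Beta.D1BFx.GhostCurrentRealised

/-! ## §1 The ghost kinetic current is the realisation of an3's colourless ghost list -/

/-- [folklore] The averaging-side `AffineAveraging.unitVec` and an3's `BubbleTransfer.unitVec` are the same vectors of `ℤ⁴`. -/
theorem unitVec_affine_eq (μ : Fin 4) : (AffineAveraging.unitVec (d := 4) μ : Site 4) = unitVec μ := rfl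

/-- [folklore] **`ghCur κ u = realK u u (ghostStn κ 1)`** — the road's colour-stripped ghost kinetic current at the fine bond `(κ, u)` IS the kernel
realisation, at the base site `u`, of an3's colourless ghost list `(ρ_{u_κ} − 1)(pt 1) ++ (−1)•(σ_{u_κ} − 1)(pt 1)`. -/
theorem ghCur_eq_realK (κ : Fin 4) (u : Pt) : ghCur κ u = realK u u (ghostStn κ (1 : Matrix Unit Unit ℝ)) := by
  funext x z a b
  rw [ghCur_apply, unitVec_affine_eq]
  simp only [ghostStn, rowDiff, colDiff, rowSh, colSh, smulS, pt, List.map_cons, List.map_nil, List.cons_append, List.nil_append,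
    realK_cons, realK_nil, Pi.add_apply, elemK_apply, add_zero, zero_add, Matrix.smul_apply, Matrix.one_apply_eq, smul_eq_mul, mul_one, neg_mul]
  split_ifs <;> norm_num

/-! ## §2 The ghost line of node A0's term list -/

/-- [folklore] **THE GHOST STENCIL OF RECORD SPLITS AS KIN + AVERAGING-JET BLOCK**: `SghAt ρ n cK cQ κ u = cK • realK u u (ghostStn κ 1) + cQ • qAntiAt ρ n κ u`
— the first summand feeds MAIN (§3), the second is block-structured (range `n`, total mass `O(cQ)` — a REST object of A3.a class). -/
theorem SghAt_split (ρ : Site 4) (n : ℕ) (cK cQ : ℝ) (κ : Fin 4) (u : Pt) :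
    SghAt ρ n cK cQ κ u = cK • realK u u (ghostStn κ (1 : Matrix Unit Unit ℝ)) + cQ • qAntiAt ρ n κ u := by
  funext x z a b
  rw [← ghCur_eq_realK]
  rfl

/-! ## §3 The ghost MAIN table -/

/-- [folklore] **THE KIN × KIN GHOST BUBBLE OVER A FROZEN EVEN LEG IS an3's GHOST TABLE**: `g` even, `B x y a b = δ_{ab}·g (y − x)` on the ghost fibre `Unit`,
first current at the base site `u`, second at `u + (v + u_μ)`: `bubble B (ghCur μ u) (ghCur ν (u + (v + u_μ))) = 2·cellForm g u_μ u_ν v`. -/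
theorem bubble_ghCur_ghCur_frozen (g : Pt → ℝ) (hg : ∀ w, g (-w) = g w) {B : MKer 4 Unit}
    (hB : ∀ x y a b, B x y a b = if a = b then g (y - x) else 0) (μ ν : Fin 4) (u v : Pt) :
    bubble B (ghCur μ u) (ghCur ν (u + (v + unitVec μ))) = 2 * cellForm g (unitVec μ) (unitVec ν) v := by
  rw [ghCur_eq_realK, ghCur_eq_realK]
  exact bubble_ghostStn_frozen g hg hB μ ν u v

end Summit.QuantumFields.BalabanUV.Beta.D1BFx.GhostCurrentRealised
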